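import Summits.QuantumFields.BalabanUV.Beta.GAN24.ExitFaceCurrentSectorSplit
import Summits.QuantumFields.BalabanUV.Beta.GAN24.LambdaSectorClassSlot
import Summits.QuantumFields.BalabanUV.Beta.GAN24.LambdaSectorClassSlotZero
import Summits.QuantumFields.BalabanUV.Beta.BubbleParity

/-!
# `BalabanUV.Beta.GAN24.CurrentSymSectorSplit` — binder row G-an2-4 ∕ (CONV-C), W-slot CT-W, conservation law (C)∕(C)sym AT ALL LEVELS, letter (R1′) of the (A)-tower of this lineage's note
# `HOME/b2b-balaban-gan24-formalise-leaf-04/g68/EXIT-FACE-CURRENT-TOWER.md` §2: **THE CLASS-WEIGHTED TWO-LEG CURRENT OF `SrecAt (j+1)` (WEIGHTED LEG FIRST, ANY FREE LEG) SPLITS INTO ITS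
# CUBIC AND BORDER SECTORS — THE Λ SECTOR DIES ON CLASS SLOT DATA; THE SAME AT LEVEL `0` FOR `S0NAt` (Wilson + border)** — so the slot↔leg-symmetrised current of `SrecAt (j+1)` vanishes at a
# free leg as soon as those of `e3OfK Lc G_j (SrecAt j)` (`CubicSectorCurrentSym`) and of `vhSAt ρ` (`VHClassCurrentSym`) do.

NOT IN PRINT; OUR BOOKKEEPING ([folklore] `tsum` bookkeeping BY NAME over leaf-10∕an2's `WardLocusRecursive.SrecAt_succ`, an2's `SpineRootedS0N.S0NAt`, this lineage's
`ExitFaceCurrentSectorSplit` (§1 summabilities, sector `LocStencil`s), `LambdaSectorClassSlot.tsum_classSlot_lamSector_eq_zero`, `LambdaSectorClassSlotZero.tsum_classSlot_lamSectorZero_eq_zero`,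
an1's `locStencil_vhSAt`, an3∕an2's `locStencil_wilsonA`; G-an2-4 formalisation swarm, leaf prover `b2b-balaban-gan24-formalise-leaf-04`, gen 69).  HONEST FRAMING (cell contract, verbatim):
«discharging `BetaPertH` makes Bałaban's UV stability UNCONDITIONAL — a real constructive-QFT result; it is NOT the continuum limit and NOT the Clay problem.»  HONEST DEPENDENCY (verbatim):
«continuum YM on T⁴ ⇐ BetaPertH ∧ nine spine estimates (0/9 proved); BetaPertH ⇐ (D1) ∧ (D4) ∧ CAP+tail; G-an2-4 gates asym, D1 and NE2/3/4.»

CONVENTION (as in `CubicSectorCurrentSym`): `P_T[s,h](p,a) := Σ'_q h(q_β)·Σ'_u s(u_ν)·T ν u q p (inl β) a + Σ'_q s(q_ν)·Σ'_u h(u_β)·T β u q p (inl ν) a`, class data `c + dΦ` with bounded `Φ`.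

WHAT ([folklore]; generic `d`, `[NeZero Lc]`, in-block root `r ∈ box Lc`, every `j`, all `cE cVH cΛ`; 0 `def`, 0 cited facts, 0 `def … : Prop`, 0 sorry): §1 `locStencil_legSwap`,
`summable_slot_locStencil`, `summable_leg_slot_fst` (convergence of the weighted-leg-first current of a local stencil family), `abs_classDatum_le`; §2 `tsum_classSlot_lamSector_eq_zero_leg`, `tsum_classSlot_lamSectorZero_eq_zero_leg` (the Λ sectors die on class slot data at EVERY free leg); §3 **`symCurrent_SrecAt_succ_eq`**,
**`sym_SrecAt_succ_of_sectors`**; §4 **`symCurrent_S0NAt_eq`**, **`sym_S0NAt_of_sectors`**.  Asserts NO value of Bałaban's tables; discharges NOTHING of (C)sym ∕ (Q-D) ∕ (Q-D-rate) ∕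
«T2Shape» ∕ «T2Drift» ∕ (hW, hWall); NEVER «G-an2-4 closed» as (CONV-C); NOT D1, NOT `BetaPertH`, NOT continuum, NOT Clay.  2026-08-23; no existing file touched.
-/

noncomputable section

open Finset
open scoped BigOperators
open Literature.MathematicalPhysics.QuantumFieldTheory
open Literature.MathematicalPhysics.QuantumFieldTheory.Balaban1983to89
open Literature.MathematicalPhysics.QuantumFieldTheory.Balaban1983to89.Beta
open B12Sec2to5 (l1 l1_nonneg)
open ExpKernelCalculus (Site MKer BiLoc)
open AffineAveraging (box toSite)
open OneStepResolventKernel (Fib LocStencil KInv)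
open OneStepKernelFamily (KInvStep)
open StepJetData (wilsonA locStencil_wilsonA)
open BalabanStepJets (lamCoeffOf)
open BalabanStepJetsSucc (lamCoeffK E2 wE wVH wΛ)
open InterLevelTransport (SLam cwsum_apply)
open AveragingHessianKernelsRooted (vhSAt hessFFAt locStencil_vhSAt hessFFAt_inl_inr)
open Summit.QuantumFields.BalabanUV.Beta.AxialDressingRooted (coDressKBmAt)
open Summit.QuantumFields.BalabanUV.Beta.BubbleParity (SLam_apply_eq_zero)
open Summit.QuantumFields.BalabanUV.Beta.SpineRooted (e3OfK S0NAt)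
open Summit.QuantumFields.BalabanUV.Beta.WardLocusRecursive (SrecAt SrecAt_succ)
open Summit.QuantumFields.BalabanUV.Beta.GAN24.ExitFaceCurrentSectorSplit (summable_slot_locStencil summable_leg_slot_locStencil exists_locStencil_eSector exists_locStencil_lamSector
  exists_locStencil_lamSectorZero)
open Summit.QuantumFields.BalabanUV.Beta.GAN24.LambdaSectorClassSlot (tsum_classSlot_lamSector_eq_zero)
open Summit.QuantumFields.BalabanUV.Beta.GAN24.LambdaSectorClassSlotZero (tsum_classSlot_lamSectorZero_eq_zero)

namespace Summit.QuantumFields.BalabanUV.Beta.GAN24.CurrentSymSectorSplit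

variable {d : ℕ} {Lc : ℕ} [NeZero Lc] {r : Fin (d + 1) → ℕ}

/-! ## §1 Convergence of the weighted-leg-first current -/

omit [NeZero Lc] in
/-- [folklore] A local stencil family stays local under the exchange of its two legs (the localisation is symmetric). -/
theorem locStencil_legSwap {T : Fin (d + 1) → Site (d + 1) → MKer (d + 1) (Fib d)} {Cs δ : ℝ} (hT : LocStencil T Cs δ) :
    LocStencil (fun ν u => fun x y a b => T ν u y x b a) Cs δ := by
  intro ν u x y a b
  have h := hT ν u y x b a
  rwa [add_comm] at h

omit [NeZero Lc] in
/-- [folklore] **THE WEIGHTED-LEG-FIRST CURRENT CONVERGES**: `q ↦ h q·Σ'_u s u·T ν u q p a b` is summable (local stencil family, bounded weights, `p a b` fixed). -/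
theorem summable_leg_slot_fst {T : Fin (d + 1) → Site (d + 1) → MKer (d + 1) (Fib d)} {Cs δ : ℝ} (hT : LocStencil T Cs δ) (hδ : 0 < δ)
    {h s : Site (d + 1) → ℝ} {Bh Bs : ℝ} (hh : ∀ q, |h q| ≤ Bh) (hs : ∀ u, |s u| ≤ Bs) (ν : Fin (d + 1)) (p : Site (d + 1)) (a b : Fib d) :
    Summable fun q : Site (d + 1) => h q * ∑' u : Site (d + 1), s u * T ν u q p a b :=
  summable_leg_slot_locStencil (locStencil_legSwap hT) hδ hh hs ν p b a

/-- [folklore] A class datum is bounded: `|c + (Φ(n+1) − Φ(n))| ≤ |c| + 2B`. -/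
theorem abs_classDatum_le (c : ℝ) (Φ : ℤ → ℝ) {B : ℝ} (hΦ : ∀ s, |Φ s| ≤ B) (n : ℤ) : |c + (Φ (n + 1) - Φ n)| ≤ |c| + (B + B) :=
  (abs_add_le _ _).trans (add_le_add le_rfl ((abs_sub _ _).trans (add_le_add (hΦ _) (hΦ _))))

/-! ## §2 The Λ sectors die on class slot data at every free leg -/

/-- [folklore] **THE LEVEL-`(j+1)` Λ SECTOR DIES ON CLASS SLOT DATA AT EVERY FREE LEG** (`LambdaSectorClassSlot` on the ff block; the other blocks of `hessFFAt` are empty). -/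
theorem tsum_classSlot_lamSector_eq_zero_leg (hr : r ∈ box (d + 1) Lc) (j : ℕ) (ν β : Fin (d + 1)) (c : ℝ) (Φ : ℤ → ℝ) {B : ℝ} (hΦ : ∀ s, |Φ s| ≤ B)
    (q p : Site (d + 1)) (a : Fib d) :
    ∑' u : Site (d + 1), (c + (Φ (u ν + 1) - Φ (u ν))) *
        SLam Lc (lamCoeffK (KInvStep (d := d) Lc (j + 1)) (E2 d Lc (j + 1)) Lc) (fun μ y => hessFFAt (toSite r) Lc μ y) ν u q p (Sum.inl β) a = 0 := by
  rcases a with κ' | m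
  · exact tsum_classSlot_lamSector_eq_zero hr j ν κ' β c Φ hΦ q p
  · have h0 : ∀ u : Site (d + 1), SLam Lc (lamCoeffK (KInvStep (d := d) Lc (j + 1)) (E2 d Lc (j + 1)) Lc) (fun μ y => hessFFAt (toSite r) Lc μ y) ν u q p (Sum.inl β) (Sum.inr m) = 0 :=
      fun u => SLam_apply_eq_zero (fun μ y x z => hessFFAt_inl_inr (toSite r) Lc μ y x z β m) ν u q p
    simp only [h0, mul_zero, tsum_zero]

/-- [folklore] **THE LEVEL-`0` Λ SECTOR DIES ON CLASS SLOT DATA AT EVERY FREE LEG** (`LambdaSectorClassSlotZero` on the ff block). -/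
theorem tsum_classSlot_lamSectorZero_eq_zero_leg (hr : r ∈ box (d + 1) Lc) (ν β : Fin (d + 1)) (c : ℝ) (Φ : ℤ → ℝ) {B : ℝ} (hΦ : ∀ s, |Φ s| ≤ B)
    (q p : Site (d + 1)) (a : Fib d) :
    ∑' u : Site (d + 1), (c + (Φ (u ν + 1) - Φ (u ν))) *
        SLam Lc (lamCoeffOf (KInv (N := Lc) (d := d)) Lc) (fun μ y => hessFFAt (toSite r) Lc μ y) ν u q p (Sum.inl β) a = 0 := by
  rcases a with κ' | m
  · exact tsum_classSlot_lamSectorZero_eq_zero hr ν κ' β c Φ hΦ q p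
  · have h0 : ∀ u : Site (d + 1), SLam Lc (lamCoeffOf (KInv (N := Lc) (d := d)) Lc) (fun μ y => hessFFAt (toSite r) Lc μ y) ν u q p (Sum.inl β) (Sum.inr m) = 0 :=
      fun u => SLam_apply_eq_zero (fun μ y x z => hessFFAt_inl_inr (toSite r) Lc μ y x z β m) ν u q p
    simp only [h0, mul_zero, tsum_zero]

/-! ## §3 Level `j+1` -/

/-- [folklore] **THE CLASS-WEIGHTED CURRENT OF `SrecAt (j+1)`, WEIGHTED LEG FIRST, ANY FREE LEG**:
`Σ'_q h(q_β)·Σ'_u s(u_ν)·SrecAt (j+1) ν u q p (inl β) a = (cE·wE_{j+1})·[same for e3OfK Lc G_j (SrecAt j)] + (cVH·wVH_{j+1})·[same for vhSAt ρ]` for a class slot datum `s`. -/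
theorem classCurrent_SrecAt_succ_eq (hr : r ∈ box (d + 1) Lc) (cE cVH cΛ : ℝ) (j : ℕ) (ν β : Fin (d + 1))
    {h : Site (d + 1) → ℝ} {Bh : ℝ} (hh : ∀ q, |h q| ≤ Bh) (c : ℝ) (Φ : ℤ → ℝ) {B : ℝ} (hΦ : ∀ s, |Φ s| ≤ B) (p : Site (d + 1)) (a : Fib d) :
    ∑' q : Site (d + 1), h q * ∑' u : Site (d + 1), (c + (Φ (u ν + 1) - Φ (u ν))) * SrecAt d Lc (toSite r) cE cVH cΛ (j + 1) ν u q p (Sum.inl β) a =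
      (cE * wE d Lc (j + 1)) * ∑' q : Site (d + 1), h q * ∑' u : Site (d + 1), (c + (Φ (u ν + 1) - Φ (u ν))) *
          e3OfK Lc (coDressKBmAt (toSite r) Lc (KInvStep (d := d) Lc j)) (SrecAt d Lc (toSite r) cE cVH cΛ j) ν u q p (Sum.inl β) a
        + (cVH * wVH d Lc (j + 1)) * ∑' q : Site (d + 1), h q * ∑' u : Site (d + 1), (c + (Φ (u ν + 1) - Φ (u ν))) * vhSAt (toSite r) d Lc rfl ν u q p (Sum.inl β) a := by
  have hLc : 1 ≤ Lc := Nat.one_le_iff_ne_zero.mpr (NeZero.ne Lc)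
  obtain ⟨C₁, δ₁, hδ₁, h1⟩ := exists_locStencil_eSector (d := d) hr cE cVH cΛ j
  have h2 := locStencil_vhSAt (d := d) hLc hr (zero_le_one)
  obtain ⟨C₃, δ₃, hδ₃, h3⟩ := exists_locStencil_lamSector (d := d) (r := r) hr j
  have hs : ∀ u : Site (d + 1), |c + (Φ (u ν + 1) - Φ (u ν))| ≤ |c| + (B + B) := fun u => abs_classDatum_le c Φ hΦ (u ν)
  have ept : ∀ u q : Site (d + 1), SrecAt d Lc (toSite r) cE cVH cΛ (j + 1) ν u q p (Sum.inl β) a =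
      (cE * wE d Lc (j + 1)) * e3OfK Lc (coDressKBmAt (toSite r) Lc (KInvStep (d := d) Lc j)) (SrecAt d Lc (toSite r) cE cVH cΛ j) ν u q p (Sum.inl β) a
        + (cVH * wVH d Lc (j + 1)) * vhSAt (toSite r) d Lc rfl ν u q p (Sum.inl β) a
        + (cΛ * wΛ d Lc (j + 1)) * SLam Lc (lamCoeffK (KInvStep (d := d) Lc (j + 1)) (E2 d Lc (j + 1)) Lc) (fun μ y => hessFFAt (toSite r) Lc μ y) ν u q p (Sum.inl β) a := by
    intro u q
    rw [SrecAt_succ]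
    simp only [Pi.add_apply, Pi.smul_apply, smul_eq_mul]
  have einner : ∀ q : Site (d + 1), ∑' u : Site (d + 1), (c + (Φ (u ν + 1) - Φ (u ν))) * SrecAt d Lc (toSite r) cE cVH cΛ (j + 1) ν u q p (Sum.inl β) a =
      (cE * wE d Lc (j + 1)) * ∑' u : Site (d + 1), (c + (Φ (u ν + 1) - Φ (u ν))) *
          e3OfK Lc (coDressKBmAt (toSite r) Lc (KInvStep (d := d) Lc j)) (SrecAt d Lc (toSite r) cE cVH cΛ j) ν u q p (Sum.inl β) a
        + (cVH * wVH d Lc (j + 1)) * ∑' u : Site (d + 1), (c + (Φ (u ν + 1) - Φ (u ν))) * vhSAt (toSite r) d Lc rfl ν u q p (Sum.inl β) a := by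
    intro q
    have e : ∀ u : Site (d + 1), (c + (Φ (u ν + 1) - Φ (u ν))) * SrecAt d Lc (toSite r) cE cVH cΛ (j + 1) ν u q p (Sum.inl β) a =
        (cE * wE d Lc (j + 1)) * ((c + (Φ (u ν + 1) - Φ (u ν))) * e3OfK Lc (coDressKBmAt (toSite r) Lc (KInvStep (d := d) Lc j)) (SrecAt d Lc (toSite r) cE cVH cΛ j) ν u q p (Sum.inl β) a)
          + (cVH * wVH d Lc (j + 1)) * ((c + (Φ (u ν + 1) - Φ (u ν))) * vhSAt (toSite r) d Lc rfl ν u q p (Sum.inl β) a)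
          + (cΛ * wΛ d Lc (j + 1)) * ((c + (Φ (u ν + 1) - Φ (u ν))) *
            SLam Lc (lamCoeffK (KInvStep (d := d) Lc (j + 1)) (E2 d Lc (j + 1)) Lc) (fun μ y => hessFFAt (toSite r) Lc μ y) ν u q p (Sum.inl β) a) := by
      intro u; rw [ept u q]; ring
    rw [tsum_congr e, (((summable_slot_locStencil h1 hδ₁ hs ν q p _ _).mul_left _).add ((summable_slot_locStencil h2 one_pos hs ν q p _ _).mul_left _)).tsum_add
      ((summable_slot_locStencil h3 hδ₃ hs ν q p _ _).mul_left _), ((summable_slot_locStencil h1 hδ₁ hs ν q p _ _).mul_left _).tsum_add ((summable_slot_locStencil h2 one_pos hs ν q p _ _).mul_left _),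
      tsum_mul_left, tsum_mul_left, tsum_mul_left, tsum_classSlot_lamSector_eq_zero_leg hr j ν β c Φ hΦ q p a, mul_zero, add_zero]
  have e : ∀ q : Site (d + 1), h q * ∑' u : Site (d + 1), (c + (Φ (u ν + 1) - Φ (u ν))) * SrecAt d Lc (toSite r) cE cVH cΛ (j + 1) ν u q p (Sum.inl β) a =
      (cE * wE d Lc (j + 1)) * (h q * ∑' u : Site (d + 1), (c + (Φ (u ν + 1) - Φ (u ν))) *
          e3OfK Lc (coDressKBmAt (toSite r) Lc (KInvStep (d := d) Lc j)) (SrecAt d Lc (toSite r) cE cVH cΛ j) ν u q p (Sum.inl β) a)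
        + (cVH * wVH d Lc (j + 1)) * (h q * ∑' u : Site (d + 1), (c + (Φ (u ν + 1) - Φ (u ν))) * vhSAt (toSite r) d Lc rfl ν u q p (Sum.inl β) a) := by
    intro q; rw [einner q]; ring
  rw [tsum_congr e, ((summable_leg_slot_fst h1 hδ₁ hh hs ν p _ _).mul_left _).tsum_add ((summable_leg_slot_fst h2 one_pos hh hs ν p _ _).mul_left _),
    tsum_mul_left, tsum_mul_left]

/-- [folklore] **THE SYMMETRISED CURRENT OF `SrecAt (j+1)` VANISHES AT A FREE LEG WHEN THOSE OF ITS CUBIC AND BORDER SECTORS DO** (class data on both the slot and the leg). -/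
theorem sym_SrecAt_succ_of_sectors (hr : r ∈ box (d + 1) Lc) (cE cVH cΛ : ℝ) (j : ℕ) (ν β : Fin (d + 1))
    (c₁ : ℝ) (Φ₁ : ℤ → ℝ) {B₁ : ℝ} (hΦ₁ : ∀ s, |Φ₁ s| ≤ B₁) (c₂ : ℝ) (Φ₂ : ℤ → ℝ) {B₂ : ℝ} (hΦ₂ : ∀ s, |Φ₂ s| ≤ B₂) (p : Site (d + 1)) (a : Fib d)
    (hE : (∑' q : Site (d + 1), (c₁ + (Φ₁ (q β + 1) - Φ₁ (q β))) * ∑' u : Site (d + 1), (c₂ + (Φ₂ (u ν + 1) - Φ₂ (u ν))) *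
          e3OfK Lc (coDressKBmAt (toSite r) Lc (KInvStep (d := d) Lc j)) (SrecAt d Lc (toSite r) cE cVH cΛ j) ν u q p (Sum.inl β) a) +
        ∑' q : Site (d + 1), (c₂ + (Φ₂ (q ν + 1) - Φ₂ (q ν))) * ∑' u : Site (d + 1), (c₁ + (Φ₁ (u β + 1) - Φ₁ (u β))) *
          e3OfK Lc (coDressKBmAt (toSite r) Lc (KInvStep (d := d) Lc j)) (SrecAt d Lc (toSite r) cE cVH cΛ j) β u q p (Sum.inl ν) a = 0)
    (hVH : (∑' q : Site (d + 1), (c₁ + (Φ₁ (q β + 1) - Φ₁ (q β))) * ∑' u : Site (d + 1), (c₂ + (Φ₂ (u ν + 1) - Φ₂ (u ν))) * vhSAt (toSite r) d Lc rfl ν u q p (Sum.inl β) a) +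
        ∑' q : Site (d + 1), (c₂ + (Φ₂ (q ν + 1) - Φ₂ (q ν))) * ∑' u : Site (d + 1), (c₁ + (Φ₁ (u β + 1) - Φ₁ (u β))) * vhSAt (toSite r) d Lc rfl β u q p (Sum.inl ν) a = 0) :
    (∑' q : Site (d + 1), (c₁ + (Φ₁ (q β + 1) - Φ₁ (q β))) * ∑' u : Site (d + 1), (c₂ + (Φ₂ (u ν + 1) - Φ₂ (u ν))) * SrecAt d Lc (toSite r) cE cVH cΛ (j + 1) ν u q p (Sum.inl β) a) +
      ∑' q : Site (d + 1), (c₂ + (Φ₂ (q ν + 1) - Φ₂ (q ν))) * ∑' u : Site (d + 1), (c₁ + (Φ₁ (u β + 1) - Φ₁ (u β))) * SrecAt d Lc (toSite r) cE cVH cΛ (j + 1) β u q p (Sum.inl ν) a = 0 := by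
  rw [classCurrent_SrecAt_succ_eq hr cE cVH cΛ j ν β (fun q => abs_classDatum_le c₁ Φ₁ hΦ₁ (q β)) c₂ Φ₂ hΦ₂ p a,
    classCurrent_SrecAt_succ_eq hr cE cVH cΛ j β ν (fun q => abs_classDatum_le c₂ Φ₂ hΦ₂ (q ν)) c₁ Φ₁ hΦ₁ p a]
  have e : ∀ (x y A B A' B' : ℝ), (x * A + y * B) + (x * A' + y * B') = x * (A + A') + y * (B + B') := by intros; ring
  rw [e, hE, hVH, mul_zero, mul_zero, add_zero]

/-! ## §4 Level `0`: the rooted native spine `S0NAt` -/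

/-- [folklore] **THE CLASS-WEIGHTED CURRENT OF `S0NAt`, WEIGHTED LEG FIRST, ANY FREE LEG**: `= cE·[same for wilsonA] + cVH·[same for vhSAt ρ]` (the level-`0` Λ sector dies on class slot data). -/
theorem classCurrent_S0NAt_eq (hr : r ∈ box (d + 1) Lc) (cE cVH cΛ : ℝ) (ν β : Fin (d + 1))
    {h : Site (d + 1) → ℝ} {Bh : ℝ} (hh : ∀ q, |h q| ≤ Bh) (c : ℝ) (Φ : ℤ → ℝ) {B : ℝ} (hΦ : ∀ s, |Φ s| ≤ B) (p : Site (d + 1)) (a : Fib d) :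
    ∑' q : Site (d + 1), h q * ∑' u : Site (d + 1), (c + (Φ (u ν + 1) - Φ (u ν))) * S0NAt d Lc (toSite r) cE cVH cΛ ν u q p (Sum.inl β) a =
      cE * ∑' q : Site (d + 1), h q * ∑' u : Site (d + 1), (c + (Φ (u ν + 1) - Φ (u ν))) * wilsonA d ν u q p (Sum.inl β) a
        + cVH * ∑' q : Site (d + 1), h q * ∑' u : Site (d + 1), (c + (Φ (u ν + 1) - Φ (u ν))) * vhSAt (toSite r) d Lc rfl ν u q p (Sum.inl β) a := by
  have hLc : 1 ≤ Lc := Nat.one_le_iff_ne_zero.mpr (NeZero.ne Lc)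
  have h1 := locStencil_wilsonA (d := d) zero_le_one
  have h2 := locStencil_vhSAt (d := d) hLc hr (zero_le_one)
  obtain ⟨C₃, δ₃, hδ₃, h3⟩ := exists_locStencil_lamSectorZero (d := d) (Lc := Lc) hr
  have hs : ∀ u : Site (d + 1), |c + (Φ (u ν + 1) - Φ (u ν))| ≤ |c| + (B + B) := fun u => abs_classDatum_le c Φ hΦ (u ν)
  have ept : ∀ u q : Site (d + 1), S0NAt d Lc (toSite r) cE cVH cΛ ν u q p (Sum.inl β) a =
      cE * wilsonA d ν u q p (Sum.inl β) a + cVH * vhSAt (toSite r) d Lc rfl ν u q p (Sum.inl β) a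
        + cΛ * SLam Lc (lamCoeffOf (KInv (N := Lc) (d := d)) Lc) (fun μ y => hessFFAt (toSite r) Lc μ y) ν u q p (Sum.inl β) a := by
    intro u q
    simp only [S0NAt, Pi.add_apply, Pi.smul_apply, smul_eq_mul]
  have einner : ∀ q : Site (d + 1), ∑' u : Site (d + 1), (c + (Φ (u ν + 1) - Φ (u ν))) * S0NAt d Lc (toSite r) cE cVH cΛ ν u q p (Sum.inl β) a =
      cE * ∑' u : Site (d + 1), (c + (Φ (u ν + 1) - Φ (u ν))) * wilsonA d ν u q p (Sum.inl β) a
        + cVH * ∑' u : Site (d + 1), (c + (Φ (u ν + 1) - Φ (u ν))) * vhSAt (toSite r) d Lc rfl ν u q p (Sum.inl β) a := by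
    intro q
    have e : ∀ u : Site (d + 1), (c + (Φ (u ν + 1) - Φ (u ν))) * S0NAt d Lc (toSite r) cE cVH cΛ ν u q p (Sum.inl β) a =
        cE * ((c + (Φ (u ν + 1) - Φ (u ν))) * wilsonA d ν u q p (Sum.inl β) a)
          + cVH * ((c + (Φ (u ν + 1) - Φ (u ν))) * vhSAt (toSite r) d Lc rfl ν u q p (Sum.inl β) a)
          + cΛ * ((c + (Φ (u ν + 1) - Φ (u ν))) * SLam Lc (lamCoeffOf (KInv (N := Lc) (d := d)) Lc) (fun μ y => hessFFAt (toSite r) Lc μ y) ν u q p (Sum.inl β) a) := by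
      intro u; rw [ept u q]; ring
    rw [tsum_congr e, (((summable_slot_locStencil h1 one_pos hs ν q p _ _).mul_left _).add ((summable_slot_locStencil h2 one_pos hs ν q p _ _).mul_left _)).tsum_add
      ((summable_slot_locStencil h3 hδ₃ hs ν q p _ _).mul_left _), ((summable_slot_locStencil h1 one_pos hs ν q p _ _).mul_left _).tsum_add ((summable_slot_locStencil h2 one_pos hs ν q p _ _).mul_left _),
      tsum_mul_left, tsum_mul_left, tsum_mul_left, tsum_classSlot_lamSectorZero_eq_zero_leg hr ν β c Φ hΦ q p a, mul_zero, add_zero]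
  have e : ∀ q : Site (d + 1), h q * ∑' u : Site (d + 1), (c + (Φ (u ν + 1) - Φ (u ν))) * S0NAt d Lc (toSite r) cE cVH cΛ ν u q p (Sum.inl β) a =
      cE * (h q * ∑' u : Site (d + 1), (c + (Φ (u ν + 1) - Φ (u ν))) * wilsonA d ν u q p (Sum.inl β) a)
        + cVH * (h q * ∑' u : Site (d + 1), (c + (Φ (u ν + 1) - Φ (u ν))) * vhSAt (toSite r) d Lc rfl ν u q p (Sum.inl β) a) := by
    intro q; rw [einner q]; ring
  rw [tsum_congr e, ((summable_leg_slot_fst h1 one_pos hh hs ν p _ _).mul_left _).tsum_add ((summable_leg_slot_fst h2 one_pos hh hs ν p _ _).mul_left _),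
    tsum_mul_left, tsum_mul_left]

/-- [folklore] **THE SYMMETRISED CURRENT OF `S0NAt` VANISHES AT A FREE LEG WHEN THOSE OF ITS WILSON AND BORDER SECTORS DO** (class data on both the slot and the leg). -/
theorem sym_S0NAt_of_sectors (hr : r ∈ box (d + 1) Lc) (cE cVH cΛ : ℝ) (ν β : Fin (d + 1))
    (c₁ : ℝ) (Φ₁ : ℤ → ℝ) {B₁ : ℝ} (hΦ₁ : ∀ s, |Φ₁ s| ≤ B₁) (c₂ : ℝ) (Φ₂ : ℤ → ℝ) {B₂ : ℝ} (hΦ₂ : ∀ s, |Φ₂ s| ≤ B₂) (p : Site (d + 1)) (a : Fib d)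
    (hW : (∑' q : Site (d + 1), (c₁ + (Φ₁ (q β + 1) - Φ₁ (q β))) * ∑' u : Site (d + 1), (c₂ + (Φ₂ (u ν + 1) - Φ₂ (u ν))) * wilsonA d ν u q p (Sum.inl β) a) +
        ∑' q : Site (d + 1), (c₂ + (Φ₂ (q ν + 1) - Φ₂ (q ν))) * ∑' u : Site (d + 1), (c₁ + (Φ₁ (u β + 1) - Φ₁ (u β))) * wilsonA d β u q p (Sum.inl ν) a = 0)
    (hVH : (∑' q : Site (d + 1), (c₁ + (Φ₁ (q β + 1) - Φ₁ (q β))) * ∑' u : Site (d + 1), (c₂ + (Φ₂ (u ν + 1) - Φ₂ (u ν))) * vhSAt (toSite r) d Lc rfl ν u q p (Sum.inl β) a) +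
        ∑' q : Site (d + 1), (c₂ + (Φ₂ (q ν + 1) - Φ₂ (q ν))) * ∑' u : Site (d + 1), (c₁ + (Φ₁ (u β + 1) - Φ₁ (u β))) * vhSAt (toSite r) d Lc rfl β u q p (Sum.inl ν) a = 0) :
    (∑' q : Site (d + 1), (c₁ + (Φ₁ (q β + 1) - Φ₁ (q β))) * ∑' u : Site (d + 1), (c₂ + (Φ₂ (u ν + 1) - Φ₂ (u ν))) * S0NAt d Lc (toSite r) cE cVH cΛ ν u q p (Sum.inl β) a) +
      ∑' q : Site (d + 1), (c₂ + (Φ₂ (q ν + 1) - Φ₂ (q ν))) * ∑' u : Site (d + 1), (c₁ + (Φ₁ (u β + 1) - Φ₁ (u β))) * S0NAt d Lc (toSite r) cE cVH cΛ β u q p (Sum.inl ν) a = 0 := by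
  rw [classCurrent_S0NAt_eq hr cE cVH cΛ ν β (fun q => abs_classDatum_le c₁ Φ₁ hΦ₁ (q β)) c₂ Φ₂ hΦ₂ p a,
    classCurrent_S0NAt_eq hr cE cVH cΛ β ν (fun q => abs_classDatum_le c₂ Φ₂ hΦ₂ (q ν)) c₁ Φ₁ hΦ₁ p a]
  have e : ∀ (x y A B A' B' : ℝ), (x * A + y * B) + (x * A' + y * B') = x * (A + A') + y * (B + B') := by intros; ring
  rw [e, hW, hVH, mul_zero, mul_zero, add_zero]

end Summit.QuantumFields.BalabanUV.Beta.GAN24.CurrentSymSectorSplit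

end
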